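import Literature.NumberTheory.EllipticCurves.Kato2004.ZetaBodyLayerValuesTwoMemberProofs
import Summits.BirchSwinnertonDyer.BirchSwinnertonDyer.Theorems.CyclotomicUntwistRohrlichAtLevel
import HarnessLib

/-!
# Route ByReductionTypeAtTwo, crux `AdditiveRankZeroAtTwo` (stmt-BirchSwinnertonDyer-19098), child C4″
# (stmt-BirchSwinnertonDyer-22618): hypothesis (i) of Kato's Thm. 13.4 at `p = 2` for EVERY elliptic curve over `ℚ`
# (reducible `E[2]` included), every analytic rank, every reduction type at `2` — modulo ONLY the MEMBER construction fact
# `Kato2004.exists_member_eulerSystem_expStar_values`, Rohrlich fed from the kernel (`PSRohrlichAtLevel`)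

Cell `bsd-2adic` (run/shared/lean/pub/bsd-2adic/), seat `bsd-2adic-addL2x` GEN 20 (R-B83 (2)+(3); companion of
`…Theorems/ByReductionTypeAtTwoAdditiveKatoEulerSystemClassNeZeroAtTwo.lean`, p744189, which displays `W[2]` irreducible).
For the 41 + 9 split-twist census rows of C4″ with reducible `E[2]` the irreducible-image construction fact does not apply; the
MEMBER fact (Kato (8.1.3)/Ex. 13.3 for the lattice `V_{ℤ_p}(f)(1)` realised on an isogenous member, transported along the
isogeny — `Kato2004.forall_exists_zetaBody_of_member`) does, and `Kato2004.exists_isEulerSystemClassTwo_ne_zero_of_member_of_rohrlich`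
(`Kato2004/ZetaBodyLayerValuesTwoMemberProofs.lean`) gives the non-zero class modulo Rohrlich; here Rohrlich is the kernel theorem
`PSRohrlichAtLevel.rohrlich_primePow_of_isNewformOf` (ANY prime, `2 ∣ N` allowed).

* `AddKatoTwo.exists_isEulerSystemClassTwo_ne_zero_of_member` — EVERY elliptic `W/ℚ`, newform `f`, cyclotomic `κ`, pin `I`:
  GRANTED `Kato2004.exists_member_eulerSystem_expStar_values` alone, `∃ s, Kato2004.IsEulerSystemClassTwo W hκ I s ∧ s ≠ 0`;
* `AddKatoTwo.nontrivial_iwasawaH1_two_of_member`, `AddKatoTwo.one_le_rank_iwasawaH1_two_of_member` ((12.2.2) at `p = 2`).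

HONEST FRAMING (D-0036/D-0054): theorems only; CONDITIONAL on the named member construction fact (hypothesis BY NAME, never
asserted); closes nothing; nothing booked; BSD is not proved by any of this. [Kato2004Asterisque] Thm. 12.5 (1) pp. 221–222,
Ex. 13.3 p. 225, §8.3 p. 181, Thm. 13.4 (i) p. 226; [RohrlichInventiones1984]; [Wuthrich2014] Prop. 8.
-/

set_option autoImplicit false
-- the summit's namespace `Summit.BirchSwinnertonDyer.BirchSwinnertonDyer` (Sub = Summit) trips `dupNamespace`
set_option linter.dupNamespace false

noncomputable section

namespace Summit.BirchSwinnertonDyer.BirchSwinnertonDyer.Theorems.AddKatoTwo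

open Field CongruenceSubgroup WeierstrassCurve Literature.NumberTheory.EllipticCurves
  Literature.NumberTheory.EllipticCurves.ModularForms Literature.NumberTheory.EllipticCurves.Kato2004

variable (W : WeierstrassCurve ℚ) [W.IsElliptic] [ContinuousSMul ℤ_[2] (W.tateModule 2)]
  [Module.Free ℤ_[2] (W.tateModule 2)] [Module.Finite ℤ_[2] (W.tateModule 2)] {κ : ZpExtension ℚ 2}
  {γ : absoluteGaloisGroup ℚ} (I : Kato2004.IwasawaH1Data W 2 κ γ)

/-- **Hypothesis (i) of Kato's Thm. 13.4 at `p = 2` for EVERY elliptic curve over `ℚ`, modulo the MEMBER construction fact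
alone.** For `W/ℚ` elliptic (structure facts of `T₂W` as instance binders; no image or reduction hypothesis), `f` a newform of
`W`, `κ` the cyclotomic `ℤ₂`-extension and any pin `I`: GRANTED `Kato2004.exists_member_eulerSystem_expStar_values`, some
`s ∈ 𝐇¹_Γ(T₂W)` is a genuine `2`-adic Euler-system class and `s ≠ 0` (Rohrlich for `f` at `2` = the kernel theorem
`PSRohrlichAtLevel.rohrlich_primePow_of_isNewformOf`). Conditional on the named construction fact `hES`.
[cite: Kato2004Asterisque, Thm. 12.5 (1) and proof (pp. 221–222), Thm. 13.4 (i) (p. 226), Ex. 13.3 (p. 225), §8.3 (p. 181)]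
[cite: RohrlichInventiones1984, Theorem (p. 409)] -/
theorem exists_isEulerSystemClassTwo_ne_zero_of_member (hκ : κ.IsCyclotomic)
    (hES : Kato2004.exists_member_eulerSystem_expStar_values) {N : ℕ} [NeZero N] (f : CuspForm (Gamma0 N) 2)
    (hf : IsNewformOf W f) :
    ∃ s : I.H, Kato2004.IsEulerSystemClassTwo W hκ I s ∧ s ≠ 0 :=
  Kato2004.exists_isEulerSystemClassTwo_ne_zero_of_member_of_rohrlich W I hκ hES f hf
    (PSRohrlichAtLevel.rohrlich_primePow_of_isNewformOf (p := 2) hf)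

/-- **`𝐇¹_Γ(T₂W) ≠ 0` for EVERY elliptic `W/ℚ`**, `κ` cyclotomic, any pin `I`, modulo the member construction fact alone.
[cite: Kato2004Asterisque, Thm. 12.5 (1) (pp. 221–222), Prop. 13.7 (p. 227)] -/
theorem nontrivial_iwasawaH1_two_of_member (hκ : κ.IsCyclotomic)
    (hES : Kato2004.exists_member_eulerSystem_expStar_values) {N : ℕ} [NeZero N] (f : CuspForm (Gamma0 N) 2)
    (hf : IsNewformOf W f) : Nontrivial I.H :=
  Kato2004.nontrivial_iwasawaH1_two_of_member_of_rohrlich W I hκ hES f hf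
    (PSRohrlichAtLevel.rohrlich_primePow_of_isNewformOf (p := 2) hf)

/-- **`1 ≤ rank_Λ 𝐇¹_Γ(T₂W)` for EVERY elliptic `W/ℚ`** — Kato (12.2.2) at `p = 2` — `κ` cyclotomic with topological generator
`γ`, any pin `I`, modulo the member construction fact alone.
[cite: Kato2004Asterisque, §12.2 (12.2.2) (p. 220), Thm. 12.4 (2) (p. 221), Thm. 12.5 (1) (pp. 221–222)] -/
theorem one_le_rank_iwasawaH1_two_of_member (hκ : κ.IsCyclotomic) (hγ : κ.IsTopGenerator γ)
    (hES : Kato2004.exists_member_eulerSystem_expStar_values) {N : ℕ} [NeZero N] (f : CuspForm (Gamma0 N) 2)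
    (hf : IsNewformOf W f) :
    1 ≤ Module.rank (IwasawaAlgebra 2) I.H :=
  Kato2004.one_le_rank_iwasawaH1_two_of_member_of_rohrlich W I hκ hγ hES f hf
    (PSRohrlichAtLevel.rohrlich_primePow_of_isNewformOf (p := 2) hf)

end Summit.BirchSwinnertonDyer.BirchSwinnertonDyer.Theorems.AddKatoTwo

end
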